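import Mathlib
import Summits.NavierStokesRegularity.NavierStokesRegularity.Theorems.L3TimeExponentPincerJawFullMorrey
import Summits.NavierStokesRegularity.NavierStokesRegularity.Theorems.L3TimeExponentPincerMorreyInterpolation
import Summits.NavierStokesRegularity.NavierStokesRegularity.Theorems.L3TimeExponentPincerSerrinMorreyBridge
import HarnessLib.Audit
import HarnessLib

/-!
# THEOREM J′ UNCONDITIONAL: `JawUpToSixOnFullMorrey` holds — the parent crux `L3CascadeJaw` is decided (up to the
# endpoint `q = 6`) on the full-Morrey-Type-I class WITHOUT Maz'ya's trace inequality
# (route `L3TimeExponentPincer`, item `stmt-NavierStokesRegularity-19499`; support file 3/3)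

Support file (cell ns-regularity-ideate, seat p4, gen 4).  0 `sorry`, no definitions.

nsreg-p2 ROUND-9 (`L3TimeExponentPincerJawFullMorrey`, p431372) proved THEOREM J′ —
`∫_{T₂}^{T} ‖u(t)‖₃^q dt < ∞` for every `0 ≤ q ≤ 6` for every frame solution (classical on `[0,T)`, Leray–Hopf,
decaying datum) that is FULL Morrey-Type-I near `T` (`∫_{B(x₀,r)} |u(t)|² ≤ M r`, all late `t`, all `x₀`, all
`r < r₁`) — CONDITIONALLY on the named fact `MazyaTraceD` (Maz'ya 1985 §1.4.2 Thm 2, `W^{1,1}` trace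
inequality; coarea/boxing, not in Mathlib).  This file discharges the condition by a different route: the
elementary interpolation inequality `(∫|u(t)|³)² ≤ (576 M₂/V₁) ‖u(t)‖₂² ‖∇u(t)‖₂²`
(`L3TimeExponentPincerMorreyInterpolation.lintegral_cube_sq_le_of_morrey`, layer cake + ball-average splitting),
with `M₂ = 2M + 2e₀/r₁` the all-radii Morrey constant (`closedBall_morrey_of_morrey_energy`), the Leray–Hopf
energy bound `‖u(t)‖₂² ≤ e₀ = 2E(u₀)` and `‖Du‖ₑ² ≤ |∇u|²_F` (`sq_opNorm_le_frobeniusNormSq`), so that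
`(∫|u(t)|³)² ≤ A · dissipRate u t` on a final window and `∫_{T₂}^T ‖u‖₃⁶ ≤ A ∫∫|∇u|² < ∞`.

PROVED here, BY NAME over nsreg-p2's nodes:
* `lintegral_six_lt_top_holds` — the statement of `…JawFullMorrey.lintegral_six_lt_top` without `MazyaTraceW11`;
* `jawUpToSixOnFullMorrey_holds : JawUpToSixOnFullMorrey` — THEOREM J′ unconditional;
* `l3CascadeJaw_clause_on_fullMorrey_holds` — the clause of the parent crux `L3CascadeJaw` (every `q ∈ (4,5)`) for
  every full-Morrey-Type-I frame solution, hypothesis-free;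
* `l3CascadeJaw_of_allBlowupsFullMorreyB : AllBlowupsFullMorreyB → L3CascadeJaw` — the rung by name, Maz'ya-free
  (nsreg-p2's `l3CascadeJaw_of_allBlowupsFullMorrey` needed `MazyaTraceD`); `AllBlowupsFullMorreyB` (every frame
  blow-up is scaled-energy Type I on all late cylinders) is implied by the hard core `NoTypeII` and is strictly
  weaker than time-Type-I (Type-II sup-rates allowed);
* `jaw_on_typeI_holds` — time-Type-I frame blow-ups are in `L^q_t L³_x` up to `T` for all `q ≤ 6` (endpoint included);
* `sliceBound_holds` — the CONCLUSION of `…JawFullMorrey.lintegral_cube_le` (`∃ c, ∫|f|³ ≤ c·growthConst·2√e₀·‖∇f‖_F`)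
  with `c = 24/V₁`, unconditional: the drop-in for every consumer of `lintegral_cube_le hMZ` (J″, power rate,
  `L⁵` Morrey-level criterion);
* `noFullMorreyBlowup_of_supercriticalSerrinL3_holds : SupercriticalSerrinL3 → NoFullMorreyTypeIBlowup` and
  `navierStokesRegularity_of_allBlowupsFullMorreyB_of_supercriticalSerrinL3 :
  AllBlowupsFullMorreyB → SupercriticalSerrinL3 → NavierStokesRegularity` — the Maz'ya-free forms of nsreg-p2's
  residual placement and Morrey pincer (`L3TimeExponentPincerSerrinMorreyBridge`, which took `MazyaTraceD`).

So what remains open of `L3CascadeJaw` after this file is exactly the class of blow-ups with UNBOUNDED scaled energy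
on some late parabolic cylinders ("Morrey-Type-II"), with no Literature debt left on the Morrey-Type-I side.
WHAT THIS IS NOT: not a claim about Navier–Stokes regularity; a kernel theorem about the full-Morrey-Type-I class.
-/

noncomputable section

namespace Summit.NavierStokesRegularity.NavierStokesRegularity.Theorems.L3TimeExponentPincerJawFullMorreyHolds

open MeasureTheory Set Function Filter Metric Topology
open scoped ENNReal NNReal
open Literature.Analysis.FluidPDE
open Summit.NavierStokesRegularity.NavierStokesRegularity.Theorems.L3TimeExponentPincerMorreyGrowth
  (V₁ V₁_nonneg volume_ball_eq growthConst coe_growthConst)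
open Summit.NavierStokesRegularity.NavierStokesRegularity.Theorems.L3TimeExponentPincerJawFullMorrey
  (FullMorreyTypeINear JawUpToSixOnFullMorrey dissipRate dissip_lt_top eLpNorm_three_rpow_eq
    AllBlowupsFullMorreyB l3CascadeJaw_clause_on_fullMorrey jaw_on_typeI)
open Summit.NavierStokesRegularity.NavierStokesRegularity.Theorems.L3TimeExponentPincerMorreyInterpolation (lintegral_cube_sq_le_of_morrey)
open Summit.NavierStokesRegularity.NavierStokesRegularity.Theorems.L3TimeExponentPincerSerrinMorreyBridge
  (NoFullMorreyTypeIBlowup navierStokesRegularity_of_morreyPincer)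
open Summit.NavierStokesRegularity.NavierStokesRegularity.Theses.L3TimeExponentPincer (SupercriticalSerrinL3)

/-! ### §5  THEOREM J′ unconditional -/

/-- Morrey on ALL closed balls from the Morrey bound below `r₁` (open balls) and the energy:
`∫_{B̄(x₀,ρ)} |f|² ≤ (2M + 2e₀/r₁) ρ`. -/
theorem closedBall_morrey_of_morrey_energy {f : (EuclideanSpace ℝ (Fin 3)) → (EuclideanSpace ℝ (Fin 3))}
    {M e₀ r₁ : ℝ} (hM : 0 < M) (he₀ : 0 ≤ e₀) (hr₁ : 0 < r₁)
    (hE : ∫⁻ y, ‖f y‖ₑ ^ 2 ≤ ENNReal.ofReal e₀)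
    (hMor : ∀ (x₀ : EuclideanSpace ℝ (Fin 3)) (r : ℝ), 0 < r → r < r₁ →
      ∫⁻ y in ball x₀ r, ‖f y‖ₑ ^ 2 ≤ ENNReal.ofReal (M * r)) :
    ∀ (x₀ : EuclideanSpace ℝ (Fin 3)) (ρ : ℝ), 0 < ρ →
      ∫⁻ y in closedBall x₀ ρ, ‖f y‖ₑ ^ 2 ≤ ENNReal.ofReal ((2 * M + 2 * e₀ / r₁) * ρ) := by
  intro x₀ ρ hρ
  by_cases h2 : 2 * ρ < r₁
  · calc ∫⁻ y in closedBall x₀ ρ, ‖f y‖ₑ ^ 2 ≤ ∫⁻ y in ball x₀ (2 * ρ), ‖f y‖ₑ ^ 2 :=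
          lintegral_mono_set (closedBall_subset_ball (by linarith))
      _ ≤ ENNReal.ofReal (M * (2 * ρ)) := hMor x₀ (2 * ρ) (by linarith) h2
      _ ≤ ENNReal.ofReal ((2 * M + 2 * e₀ / r₁) * ρ) := by
          apply ENNReal.ofReal_le_ofReal
          have : 0 ≤ 2 * e₀ / r₁ * ρ := by positivity
          nlinarith
  · rw [not_lt] at h2
    calc ∫⁻ y in closedBall x₀ ρ, ‖f y‖ₑ ^ 2 ≤ ∫⁻ y, ‖f y‖ₑ ^ 2 := setLIntegral_le_lintegral _ _
      _ ≤ ENNReal.ofReal e₀ := hE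
      _ ≤ ENNReal.ofReal ((2 * M + 2 * e₀ / r₁) * ρ) := by
          apply ENNReal.ofReal_le_ofReal
          have h1 : e₀ ≤ 2 * e₀ / r₁ * ρ := by
            rw [div_mul_eq_mul_div, le_div_iff₀ hr₁]
            nlinarith
          have : 0 ≤ 2 * M * ρ := by positivity
          nlinarith

/-- **J′ UNCONDITIONAL, sixth-power form**: on the full-Morrey class, `t ↦ ‖u(t)‖₃⁶` is integrable up to `T`,
with the slice inequality `(∫|u(t)|³)² ≤ A · ∫|∇u(t)|²` for all late `t` — the statement of
`L3TimeExponentPincerJawFullMorrey.lintegral_six_lt_top` WITHOUT the hypothesis `MazyaTraceW11`. -/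
theorem lintegral_six_lt_top_holds {ν T : ℝ} (hν : 0 < ν) (hT : 0 < T)
    {u : ℝ → (EuclideanSpace ℝ (Fin 3)) → (EuclideanSpace ℝ (Fin 3))} {p : ℝ → (EuclideanSpace ℝ (Fin 3)) → ℝ}
    (hcl : IsClassicalNSSolutionOn (Ico 0 T) ν 0 u p)
    (hLH : IsLerayHopfOn T ν 0 (u 0) u) (hFM : FullMorreyTypeINear u T) :
    ∃ T₂ ∈ Ioo 0 T, ∃ A : ℝ≥0∞, A ≠ ⊤ ∧
      (∀ t ∈ Ioo T₂ T, (∫⁻ y, ‖u t y‖ₑ ^ (3 : ℕ)) ^ 2 ≤ A * dissipRate u t) ∧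
      (∫⁻ t in Ioo T₂ T, eLpNorm (u t) 3 volume ^ (6 : ℝ)) < ⊤ := by
  obtain ⟨M, hM, r₁, hr₁, T₁, hT₁, hMor⟩ := hFM
  set e₀ : ℝ := 2 * VectorCalculus.kineticEnergy (u 0) with he₀
  have he₀nn : 0 ≤ e₀ := mul_nonneg zero_le_two (kineticEnergy_nonneg _)
  set T₂ : ℝ := max T₁ (T / 2) with hT₂
  have hT₂mem : T₂ ∈ Ioo 0 T := ⟨lt_max_of_lt_right (by linarith), max_lt hT₁ (by linarith)⟩
  set M₂ : ℝ := 2 * M + 2 * e₀ / r₁ with hM₂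
  have hM₂pos : 0 < M₂ := by positivity
  set A : ℝ≥0∞ := ENNReal.ofReal (576 * M₂ / V₁) * ENNReal.ofReal e₀ with hA
  have hAtop : A ≠ ⊤ := ENNReal.mul_ne_top ENNReal.ofReal_ne_top ENNReal.ofReal_ne_top
  have hslice : ∀ t ∈ Ioo T₂ T, (∫⁻ y, ‖u t y‖ₑ ^ (3 : ℕ)) ^ 2 ≤ A * dissipRate u t := by
    intro t ht
    have htT₁ : T₁ < t := lt_of_le_of_lt (le_max_left _ _) ht.1
    have ht0 : 0 < t := hT₂mem.1.trans ht.1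
    have htc : t ∈ Ico 0 T := ⟨ht0.le, ht.2⟩
    have hE : ∫⁻ y, ‖u t y‖ₑ ^ 2 ≤ ENNReal.ofReal e₀ := hLH.lintegral_enorm_sq_le hν.le ⟨ht0.le, ht.2.le⟩
    have hf : ContDiff ℝ 1 (u t) := (hcl.contDiff_velocity htc).of_le (by exact_mod_cast le_top)
    have hMor' := closedBall_morrey_of_morrey_energy hM he₀nn hr₁ hE
      (fun x₀ r hr hrr => hMor t ⟨htT₁, ht.2⟩ x₀ r hr hrr)
    have h1 := lintegral_cube_sq_le_of_morrey hf hM₂pos hMor' (ne_top_of_le_ne_top ENNReal.ofReal_ne_top hE)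
    have hD : ∫⁻ y, ‖fderiv ℝ (u t) y‖ₑ ^ 2 ≤ dissipRate u t := by
      change ∫⁻ y, ‖fderiv ℝ (u t) y‖ₑ ^ 2 ≤ ∫⁻ y, ENNReal.ofReal (frobeniusNormSq (fderiv ℝ (u t) y))
      refine lintegral_mono fun y => ?_
      rw [← ofReal_norm, ← ENNReal.ofReal_pow (norm_nonneg _)]
      exact ENNReal.ofReal_le_ofReal (sq_opNorm_le_frobeniusNormSq _)
    calc (∫⁻ y, ‖u t y‖ₑ ^ (3 : ℕ)) ^ 2
        ≤ ENNReal.ofReal (576 * M₂ / V₁) * (∫⁻ y, ‖u t y‖ₑ ^ 2) * ∫⁻ y, ‖fderiv ℝ (u t) y‖ₑ ^ 2 := h1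
      _ ≤ ENNReal.ofReal (576 * M₂ / V₁) * ENNReal.ofReal e₀ * dissipRate u t := by gcongr
      _ = A * dissipRate u t := by rw [hA]
  refine ⟨T₂, hT₂mem, A, hAtop, hslice, ?_⟩
  have hdiss : ∫⁻ t in Ioo 0 T, dissipRate u t < ⊤ := dissip_lt_top hcl hLH
  calc ∫⁻ t in Ioo T₂ T, eLpNorm (u t) 3 volume ^ (6 : ℝ)
      = ∫⁻ t in Ioo T₂ T, (∫⁻ y, ‖u t y‖ₑ ^ (3 : ℕ)) ^ 2 := by
        refine setLIntegral_congr_fun measurableSet_Ioo fun t _ => ?_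
        rw [eLpNorm_three_rpow_eq, show (6 : ℝ) / 3 = 2 by norm_num, ENNReal.rpow_two]
    _ ≤ ∫⁻ t in Ioo T₂ T, A * dissipRate u t := setLIntegral_mono' measurableSet_Ioo hslice
    _ = A * ∫⁻ t in Ioo T₂ T, dissipRate u t := lintegral_const_mul' _ _ hAtop
    _ ≤ A * ∫⁻ t in Ioo 0 T, dissipRate u t :=
        mul_le_mul_of_nonneg_left (lintegral_mono_set (Ioo_subset_Ioo_left hT₂mem.1.le)) bot_le
    _ < ⊤ := ENNReal.mul_lt_top hAtop.lt_top hdiss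

/-- **THEOREM J′ (unconditional).**  On the full-Morrey-Type-I class of the Leray–Hopf frame,
`∫_{T₂}^{T} ‖u(t)‖₃^q dt < ∞` for EVERY `0 ≤ q ≤ 6` — the named statement `JawUpToSixOnFullMorrey` of
`L3TimeExponentPincerJawFullMorrey`, now WITHOUT Maz'ya's trace inequality. -/
theorem jawUpToSixOnFullMorrey_holds : JawUpToSixOnFullMorrey := by
  intro ν T hν hT u p hcl hLH hFM q hq0 hq6
  obtain ⟨T₂, hT₂, A, -, -, h6⟩ := lintegral_six_lt_top_holds hν hT hcl hLH hFM
  refine ⟨T₂, hT₂, ?_⟩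
  have hpt : ∀ t ∈ Ioo T₂ T, eLpNorm (u t) 3 volume ^ q ≤ eLpNorm (u t) 3 volume ^ (6 : ℝ) + 1 := by
    intro t _
    by_cases h1 : 1 ≤ eLpNorm (u t) 3 volume
    · exact (ENNReal.rpow_le_rpow_of_exponent_le h1 hq6).trans le_self_add
    · exact (ENNReal.rpow_le_one (le_of_not_ge h1) hq0).trans le_add_self
  calc ∫⁻ t in Ioo T₂ T, eLpNorm (u t) 3 volume ^ q
      ≤ ∫⁻ t in Ioo T₂ T, (eLpNorm (u t) 3 volume ^ (6 : ℝ) + 1) := setLIntegral_mono' measurableSet_Ioo hpt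
    _ = (∫⁻ t in Ioo T₂ T, eLpNorm (u t) 3 volume ^ (6 : ℝ)) + ∫⁻ t in Ioo T₂ T, (1 : ℝ≥0∞) :=
        lintegral_add_right' _ aemeasurable_const
    _ < ⊤ := by
        refine ENNReal.add_lt_top.2 ⟨h6, ?_⟩
        rw [setLIntegral_const, Real.volume_Ioo]
        exact ENNReal.mul_lt_top ENNReal.one_lt_top ENNReal.ofReal_lt_top

/-- **The parent crux's clause on the full-Morrey class, unconditional**: every frame solution that is
full-Morrey-Type-I near `T` satisfies `∫_{T₂}^{T} ‖u(t)‖₃^q dt < ∞` for every `q ∈ (4,5)`. -/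
theorem l3CascadeJaw_clause_on_fullMorrey_holds :
    ∀ q : ℝ, 4 < q → q < 5 → ∀ (ν T : ℝ), 0 < ν → 0 < T →
      ∀ (u : ℝ → (EuclideanSpace ℝ (Fin 3)) → (EuclideanSpace ℝ (Fin 3))) (p : ℝ → (EuclideanSpace ℝ (Fin 3)) → ℝ),
      IsClassicalNSSolutionOn (Ico 0 T) ν 0 u p → IsLerayHopfOn T ν 0 (u 0) u →
      HasRapidSpatialDecay (u 0) → FullMorreyTypeINear u T →
        ∃ T₂ ∈ Ioo 0 T, (∫⁻ t in Ioo T₂ T, eLpNorm (u t) 3 volume ^ q) < ⊤ :=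
  l3CascadeJaw_clause_on_fullMorrey jawUpToSixOnFullMorrey_holds

/-- **Rung BY NAME, Maz'ya-free**: "every frame blow-up is full-Morrey-Type-I" (`AllBlowupsFullMorreyB`,
implied by the hard core `NoTypeII`) ⇒ the parent crux `L3CascadeJaw` (`stmt-NavierStokesRegularity-19499`);
smooth branch = the landed `jawSmoothBranch_holds`. -/
theorem l3CascadeJaw_of_allBlowupsFullMorreyB (hA : AllBlowupsFullMorreyB) :
    Summit.NavierStokesRegularity.NavierStokesRegularity.Theses.L3TimeExponentPincer.L3CascadeJaw := by
  intro q hq4 hq5 ν T hν hT u p hcl hLH hdec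
  by_cases hext : HasSmoothExtensionPast ν 0 u T
  · exact Summit.NavierStokesRegularity.NavierStokesRegularity.Theorems.L3TimeExponentPincerSmoothBranch.jawSmoothBranch_holds
      q hq4 hq5 ν T hν hT u p hcl hLH hdec hext
  · exact l3CascadeJaw_clause_on_fullMorrey_holds q hq4 hq5 ν T hν hT u p hcl hLH hdec
      (hA ν T hν hT u p hcl hLH hdec hext)

/-- Corollary: every time-Type-I frame blow-up is in `L^q_t L³_x` up to `T` for all `q ≤ 6`
(endpoint `q = 6` included; the elementary rung `L3CascadeJaw_rung` gives `q < 6`). -/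
theorem jaw_on_typeI_holds {ν T : ℝ} (hν : 0 < ν) (hT : 0 < T)
    {u : ℝ → (EuclideanSpace ℝ (Fin 3)) → (EuclideanSpace ℝ (Fin 3))} {p : ℝ → (EuclideanSpace ℝ (Fin 3)) → ℝ}
    (hcl : IsClassicalNSSolutionOn (Ico 0 T) ν 0 u p) (hLH : IsLerayHopfOn T ν 0 (u 0) u)
    (hdec : HasRapidSpatialDecay (u 0)) (hTI : IsTypeIBlowup u T) {q : ℝ} (hq0 : 0 ≤ q) (hq6 : q ≤ 6) :
    ∃ T₂ ∈ Ioo 0 T, (∫⁻ t in Ioo T₂ T, eLpNorm (u t) 3 volume ^ q) < ⊤ :=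
  jaw_on_typeI jawUpToSixOnFullMorrey_holds hν hT hcl hLH hdec hTI hq0 hq6


/-- **Residual placement, Maz'ya-free**: the residual crux `SupercriticalSerrinL3` (`stmt-NavierStokesRegularity-19500`)
excludes every scaled-energy-Type-I blow-up (nsreg-p2's `noFullMorreyBlowup_of_supercriticalSerrinL3` without
`MazyaTraceD`). -/
theorem noFullMorreyBlowup_of_supercriticalSerrinL3_holds (h : SupercriticalSerrinL3) : NoFullMorreyTypeIBlowup := by
  obtain ⟨q, hq4, hq5, hS⟩ := h
  intro ν T hν hT u p hcl hLH hdec hFM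
  exact hS ν T hν hT u p hcl hLH hdec
    (jawUpToSixOnFullMorrey_holds ν T hν hT u p hcl hLH hFM q (by linarith) (by linarith))

/-- **The Morrey pincer with the residual crux as the Type-I jaw, Maz'ya-free**:
`AllBlowupsFullMorreyB → SupercriticalSerrinL3 → NavierStokesRegularity` (nsreg-p2's
`navierStokesRegularity_of_allBlowupsFullMorrey_of_supercriticalSerrinL3` without `MazyaTraceD`). -/
theorem navierStokesRegularity_of_allBlowupsFullMorreyB_of_supercriticalSerrinL3
    (hA : AllBlowupsFullMorreyB) (h : SupercriticalSerrinL3) : NavierStokesRegularity :=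
  navierStokesRegularity_of_morreyPincer hA (noFullMorreyBlowup_of_supercriticalSerrinL3_holds h)


/-! ### The slice bound in nsreg-p2's currency (for the J″ / Morrey-rate files) -/

/-- **The slice bound of THEOREM J′ in nsreg-p2's currency, UNCONDITIONAL**: the conclusion of
`L3TimeExponentPincerJawFullMorrey.lintegral_cube_le` (there derived from `MazyaTraceW11`) with the explicit
absolute constant `c = 24 / V₁`: for smooth `f` with `∫|f|² ≤ e₀` and the Morrey bound `∫_{B(x₀,r)}|f|² ≤ M r`
(`r < r₁`), `∫|f|³ ≤ c · growthConst M e₀ r₁ · 2 √e₀ · ‖∇f‖_{2,F}`.  So every consumer of `lintegral_cube_le hMZ`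
(J″ `jaw_of_morreyRate`, the power-rate clause, the `L⁵`-Morrey-level criterion) can drop `MazyaTraceW11`. -/
theorem sliceBound_holds :
    ∃ c : ℝ≥0, ∀ (f : (EuclideanSpace ℝ (Fin 3)) → (EuclideanSpace ℝ (Fin 3))), ContDiff ℝ (⊤ : ℕ∞) f →
      ∀ (M e₀ r₁ : ℝ), 0 < M → 0 ≤ e₀ → 0 < r₁ →
      ∫⁻ y, ‖f y‖ₑ ^ 2 ≤ ENNReal.ofReal e₀ →
      (∀ x₀ : (EuclideanSpace ℝ (Fin 3)), ∀ r : ℝ, 0 < r → r < r₁ →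
        ∫⁻ y in ball x₀ r, ‖f y‖ₑ ^ 2 ≤ ENNReal.ofReal (M * r)) →
      ∫⁻ y, ‖f y‖ₑ ^ (3 : ℕ) ≤ (c : ℝ≥0∞) * growthConst M e₀ r₁ *
        (2 * (ENNReal.ofReal e₀) ^ (1 / 2 : ℝ) *
          (∫⁻ x, ENNReal.ofReal (frobeniusNormSq (fderiv ℝ f x))) ^ (1 / 2 : ℝ)) := by
  have hV : 0 < V₁ := by
    rw [V₁]
    exact ENNReal.toReal_pos (measure_ball_pos volume (0 : EuclideanSpace ℝ (Fin 3)) one_pos).ne'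
      measure_ball_lt_top.ne
  refine ⟨(24 / V₁).toNNReal, fun f hf M e₀ r₁ hM he₀ hr₁ hE hMor => ?_⟩
  have hf1 : ContDiff ℝ 1 f := hf.of_le (by exact_mod_cast le_top)
  set M₂ : ℝ := 2 * M + 2 * e₀ / r₁ with hM₂
  have hM₂pos : 0 < M₂ := by positivity
  set X : ℝ≥0∞ := ∫⁻ y, ‖f y‖ₑ ^ (3 : ℕ) with hX
  set D : ℝ≥0∞ := ∫⁻ x, ENNReal.ofReal (frobeniusNormSq (fderiv ℝ f x)) with hD
  set G : ℝ≥0∞ := (growthConst M e₀ r₁ : ℝ≥0∞) with hG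
  set c : ℝ≥0∞ := (((24 / V₁).toNNReal : ℝ≥0) : ℝ≥0∞) with hc
  have hMor' := closedBall_morrey_of_morrey_energy hM he₀ hr₁ hE hMor
  have h1 := lintegral_cube_sq_le_of_morrey hf1 hM₂pos hMor' (ne_top_of_le_ne_top ENNReal.ofReal_ne_top hE)
  have hDle : ∫⁻ y, ‖fderiv ℝ f y‖ₑ ^ 2 ≤ D := lintegral_mono fun y => by
    rw [← ofReal_norm, ← ENNReal.ofReal_pow (norm_nonneg _)]
    exact ENNReal.ofReal_le_ofReal (sq_opNorm_le_frobeniusNormSq _)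
  have h2 : X ^ 2 ≤ ENNReal.ofReal (576 * M₂ / V₁) * ENNReal.ofReal e₀ * D := h1.trans (by gcongr)
  -- the constant: `576 M₂ / V₁ ≤ (c · growthConst · 2)²`
  set S : ℝ := Real.sqrt M + Real.sqrt (e₀ / r₁) with hS
  have hS0 : 0 ≤ S := by positivity
  have hS2 : M + e₀ / r₁ ≤ S ^ 2 := by
    rw [hS, add_sq, Real.sq_sqrt hM.le, Real.sq_sqrt (div_nonneg he₀ hr₁.le)]
    nlinarith [Real.sqrt_nonneg M, Real.sqrt_nonneg (e₀ / r₁)]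
  have key : 576 * M₂ / V₁ ≤ (24 / V₁ * (Real.sqrt V₁ * S) * 2) ^ 2 := by
    have hV' : Real.sqrt V₁ ^ 2 = V₁ := Real.sq_sqrt hV.le
    have hrhs : (24 / V₁ * (Real.sqrt V₁ * S) * 2) ^ 2 = 2304 * S ^ 2 / V₁ := by
      rw [show (24 / V₁ * (Real.sqrt V₁ * S) * 2) ^ 2 = 2304 * Real.sqrt V₁ ^ 2 * S ^ 2 / V₁ ^ 2 by ring,
        hV']
      field_simp
    rw [hrhs]
    have h22 : (2 : ℝ) * e₀ / r₁ = 2 * (e₀ / r₁) := mul_div_assoc _ _ _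
    exact div_le_div_of_nonneg_right (by rw [hM₂, h22]; nlinarith [hS2, sq_nonneg S]) hV.le
  have hconst : ENNReal.ofReal (576 * M₂ / V₁) ≤ (c * G * 2) ^ 2 := by
    rw [hc, hG, coe_growthConst, show (((24 / V₁).toNNReal : ℝ≥0) : ℝ≥0∞) = ENNReal.ofReal (24 / V₁) from rfl,
      ← ENNReal.ofReal_mul (by positivity), show (2 : ℝ≥0∞) = ENNReal.ofReal 2 by norm_num,
      ← ENNReal.ofReal_mul (by positivity), ← ENNReal.ofReal_pow (by positivity)]
    exact ENNReal.ofReal_le_ofReal key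
  -- assemble and take square roots
  have h3 : X ^ 2 ≤ (c * G * (2 * (ENNReal.ofReal e₀) ^ (1 / 2 : ℝ) * D ^ (1 / 2 : ℝ))) ^ 2 := by
    calc X ^ 2 ≤ ENNReal.ofReal (576 * M₂ / V₁) * ENNReal.ofReal e₀ * D := h2
      _ ≤ (c * G * 2) ^ 2 * ENNReal.ofReal e₀ * D := by gcongr
      _ = (c * G * (2 * (ENNReal.ofReal e₀) ^ (1 / 2 : ℝ) * D ^ (1 / 2 : ℝ))) ^ 2 := by
          have he : ((ENNReal.ofReal e₀) ^ (1 / 2 : ℝ)) ^ 2 = ENNReal.ofReal e₀ := by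
            rw [← ENNReal.rpow_two, ← ENNReal.rpow_mul]; norm_num
          have hd : (D ^ (1 / 2 : ℝ)) ^ 2 = D := by
            rw [← ENNReal.rpow_two, ← ENNReal.rpow_mul]; norm_num
          rw [show (c * G * (2 * (ENNReal.ofReal e₀) ^ (1 / 2 : ℝ) * D ^ (1 / 2 : ℝ))) ^ 2 =
            (c * G * 2) ^ 2 * ((ENNReal.ofReal e₀) ^ (1 / 2 : ℝ)) ^ 2 * (D ^ (1 / 2 : ℝ)) ^ 2 by ring, he, hd]
  exact (ENNReal.pow_le_pow_left_iff two_ne_zero).1 h3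

end Summit.NavierStokesRegularity.NavierStokesRegularity.Theorems.L3TimeExponentPincerJawFullMorreyHolds

end
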